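import Literature.Computability.Complexity.ScaledPCPQueriesN
import Literature.Computability.Complexity.HonestMessages
import HarnessLib

/-!
# The decision map of the scaled PCP verifier with residues (spec level)

Literature / complexity toolkit, fifth MACHINE-LAYER brick for `ScaledPCP.verifier' M T`
(`ScaledPCPVerifier.lean`). Its decision map `decideOf x ρ a` accepts on bad coins and otherwise runs
the algebraic verifier `AlgebraicPCP.Accept` (the `Tt` low-degree tests, the `K` sumcheck round
checks, the final check against the self-corrected reads) on the proof REBUILT FROM THE ANSWERS
(`proofFromAnswers`: an oracle value is the first answer block listed for its point, a message is
the run of coefficient blocks listed for its prefix). This file restates that decision over RESIDUES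
— the answer bits `a`, the residue tape (`ScaledPCPTapeFP.lean`) and the residue-level point lists of
`ScaledPCPQueriesN.lean` — and proves the two equal:

* `valN` (an answer block mod `p`, `= valAt`), `yAtN` (the rebuilt oracle at a listed point, through
  `List.idxOf` on residue lists: `idxOf_eq_of_forall₂`), `dcN` (the difference coefficients
  `(-1)^{d+1-j} C(d+1, j)`, through `chooseM`, binomials mod `p` as short products), `scWN` (the
  interpolation weights of the self-corrector at `0`);
* `ldtSumN`, `csN` (the coefficient residues of message `i`, `coeff_msgs`/`eval_msgs`),
  `roundLHS`, `chainN`, `scValN` (`= scVal`), `yssN`, `finalLHS` (`= finalVal`) and **`decideN`** with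
  **`decideOf_eq_decideN : decideOf M T x ρ a = decideN M T x ρ a`**.

The polynomial running time is the sequel `ScaledPCPDecideFP.lean`. All proved; no named fact.

## References

* L. Babai, L. Fortnow, L. Levin, M. Szegedy, *Checking computations in polylogarithmic time*,
  STOC 1991, §5 (the verifier's checks) [BFLS1991].
* S. Arora, B. Barak, *Computational Complexity: A Modern Approach*, CUP 2009, §8.3.2 (sumcheck
  round checks), §8.6.2 (self-correction), Def. 11.4 [AroraBarakCC2009].
* R. Rubinfeld, M. Sudan, *Robust characterizations of polynomials with applications to program
  testing*, SIAM J. Comput. 25 (1996), §4 (the evenly-spaced test) [RubinfeldSudan1996].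
-/

noncomputable section

open Finset Polynomial

namespace Literature.Computability.Complexity

namespace ScaledPCP

open CodeFP Turing Tableau TableauCSP AlgebraicPCP LowDegreeTest ModArith TabEval DigitPoly _root_.Computability

attribute [local instance] Turing.FinTM2.kFin Turing.FinTM2.ΛFin Turing.FinTM2.σFin
  Turing.FinTM2.Γk₀Fin

/-! ### Generic pieces -/

/-- **First occurrences agree along a bi-unique relation.** [folklore] -/
theorem idxOf_eq_of_forall₂ {α β : Type} [BEq α] [LawfulBEq α] [BEq β] [LawfulBEq β] {R : α → β → Prop} {a : α} {b : β} (hab : R a b)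
    (huniq : ∀ a' b', R a' b' → (a' = a ↔ b' = b)) : ∀ {l : List α} {l' : List β}, List.Forall₂ R l l' → l.idxOf a = l'.idxOf b
  | _, _, List.Forall₂.nil => rfl
  | _, _, List.Forall₂.cons (a := a') (b := b') h hl => by
    by_cases ha : a' = a
    · rw [List.idxOf_cons_eq _ ha, List.idxOf_cons_eq _ ((huniq a' b' h).1 ha)]
    · rw [List.idxOf_cons_ne _ ha, List.idxOf_cons_ne _ (fun hb => ha ((huniq a' b' h).2 hb)), idxOf_eq_of_forall₂ hab huniq hl]

/-- `PtRel` is bi-unique. [folklore] -/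
theorem ptRel_biunique {p m : ℕ} [NeZero p] {w w' : Fin m → ZMod p} {wl wl' : List ℕ} (h : PtRel w wl) (h' : PtRel w' wl') :
    w' = w ↔ wl' = wl := by
  constructor
  · rintro rfl
    apply List.ext_getElem (by rw [h.1, h'.1])
    intro u h1 h2
    have e1 := h.2 ⟨u, by rw [← h'.1]; exact h1⟩
    have e2 := h'.2 ⟨u, by rw [← h'.1]; exact h1⟩
    rw [List.getD_eq_getElem _ _ h2] at e1
    rw [List.getD_eq_getElem _ _ h1] at e2
    rw [← e1, ← e2]
  · rintro rfl
    funext u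
    apply ZMod.val_injective
    rw [h.2 u, h'.2 u]

/-- Partial sums are below the total. [folklore] -/
theorem sum_castLE_le {N k : ℕ} (hk : k ≤ N) (f : Fin N → ℕ) : ∑ i : Fin k, f (Fin.castLE hk i) ≤ ∑ i, f i := by
  calc ∑ i : Fin k, f (Fin.castLE hk i) = ∑ i ∈ (univ : Finset (Fin k)).map (Fin.castLEEmb hk), f i := by rw [sum_map]; rfl
    _ ≤ ∑ i, f i := sum_le_sum_of_subset (subset_univ _)

/-! ### The self-correction weights and the difference coefficients -/

section Weights

variable {p : ℕ} [hp : Fact p.Prime]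

/-- **The interpolation weight of node `i + 1` at `0`** among the nodes `1, …, d + 1`:
`∏_{j ≠ i} ((i+1) - (j+1))⁻¹ · (0 - (j+1))` (the factor `j = i` being `1`). [cite: AroraBarakCC2009, §8.6.2] -/
def scWN (p d i : ℕ) : ℕ :=
  prodM p ((List.range (d + 1)).map fun j => if j = i then 1 % p else mulM p (invM p (subM p (i + 1) (j + 1))) (negM p (j + 1)))

/-- `eval 0` of a basis divisor. [folklore] -/
theorem eval_zero_basisDivisor (u v : ZMod p) : (Lagrange.basisDivisor u v).eval 0 = (u - v)⁻¹ * (0 - v) := by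
  simp [Lagrange.basisDivisor]

/-- **The weights are the Lagrange basis values at `0`.** [folklore] -/
theorem cast_scWN (hp3 : p ≠ 2) (d : ℕ) (i : Fin (d + 1)) :
    ((scWN p d i : ℕ) : ZMod p) = (Lagrange.basis (Finset.univ : Finset (Fin (d + 1))) (scNode (F := ZMod p) d) i).eval 0 := by
  haveI : NeZero p := ⟨hp.out.ne_zero⟩
  rw [Lagrange.basis, Polynomial.eval_prod, scWN, natCast_prodM, List.map_map, prod_map_range]
  -- the Finset product over `univ.erase i` as a product over `range (d+1)` with the factor `i` set to `1`
  set g : ℕ → ZMod p := fun j => if j = (i : ℕ) then (1 : ZMod p) else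
    ((((i : ℕ) + 1 : ℕ) : ZMod p) - (((j + 1 : ℕ) : ZMod p)))⁻¹ * (0 - ((j + 1 : ℕ) : ZMod p)) with hg
  have h1 : ∏ j ∈ (univ : Finset (Fin (d + 1))).erase i, (Lagrange.basisDivisor (scNode (F := ZMod p) d i) (scNode d j)).eval 0 =
      ∏ j : Fin (d + 1), g j := by
    rw [← Finset.prod_erase (s := univ) (a := i) (f := fun j : Fin (d + 1) => g j) (by simp [hg])]
    refine Finset.prod_congr rfl fun j hj => ?_
    have hji : (j : ℕ) ≠ i := fun h => (Finset.mem_erase.1 hj).1 (Fin.ext h)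
    rw [hg]
    dsimp only
    rw [if_neg hji, eval_zero_basisDivisor]
    rfl
  rw [h1, Fin.prod_univ_eq_prod_range g (d + 1)]
  refine Finset.prod_congr rfl fun j _ => ?_
  rw [Function.comp_apply, hg]
  dsimp only
  by_cases hj : j = (i : ℕ)
  · rw [if_pos hj, if_pos hj, ZMod.natCast_mod, Nat.cast_one]
  · rw [if_neg hj, if_neg hj, natCast_mulM, natCast_invM _ (Or.inr hp3), natCast_subM, natCast_negM]
    ring

/-- **Binomial coefficients modulo `p` without large numbers**: `C(n, j) = ∏_{t<j} (n - t) (t + 1)⁻¹`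
(valid for `j ≤ n < p`). [folklore] -/
def chooseM (p n j : ℕ) : ℕ := prodM p ((List.range j).map fun t => mulM p (n - t) (invM p (t + 1)))

/-- `chooseM` is the binomial coefficient. [folklore] -/
theorem cast_chooseM {n j : ℕ} (hn : n < p) (hj : j ≤ n) : ((chooseM p n j : ℕ) : ZMod p) = (n.choose j : ℕ) := by
  rw [chooseM, natCast_prodM, List.map_map, prod_map_range]
  have hfac : ((j.factorial : ℕ) : ZMod p) ≠ 0 := by
    rw [Ne, ZMod.natCast_eq_zero_iff, hp.out.dvd_factorial]; omega
  have h1 : ∏ t ∈ range j, ((Nat.cast : ℕ → ZMod p) ∘ fun t => mulM p (n - t) (invM p (t + 1))) t =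
      (∏ t ∈ range j, ((n - t : ℕ) : ZMod p)) * (∏ t ∈ range j, ((t + 1 : ℕ) : ZMod p))⁻¹ := by
    rw [← prod_inv_distrib, ← prod_mul_distrib]
    refine prod_congr rfl fun t ht => ?_
    have ht' : ((t + 1 : ℕ) : ZMod p) ≠ 0 := by
      rw [Ne, ZMod.natCast_eq_zero_iff]; exact fun h => by have := Nat.le_of_dvd (Nat.succ_pos _) h; have := mem_range.1 ht; omega
    rw [Function.comp_apply, natCast_mulM, natCast_invM _ (Or.inl ht')]
  rw [h1, ← Nat.cast_prod, ← Nat.descFactorial_eq_prod_range, Nat.descFactorial_eq_factorial_mul_choose, ← Nat.cast_prod,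
    prod_range_add_one_eq_factorial, Nat.cast_mul, mul_comm, ← mul_assoc, inv_mul_cancel₀ hfac, one_mul]

/-- **The difference coefficients `(-1)^{d+1-j} C(d+1, j)` as residues.** [cite: RubinfeldSudan1996, §4] -/
def dcN (p d j : ℕ) : ℕ := if (d + 1 - j) % 2 = 0 then chooseM p (d + 1) j else negM p (chooseM p (d + 1) j)

/-- `dcN` is `diffCoeff`. [folklore] -/
theorem cast_dcN {d j : ℕ} (hd : d + 1 < p) (hj : j ≤ d + 1) : ((dcN p d j : ℕ) : ZMod p) = diffCoeff d j := by
  haveI : NeZero p := ⟨hp.out.ne_zero⟩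
  unfold dcN diffCoeff
  by_cases h : (d + 1 - j) % 2 = 0
  · rw [if_pos h, cast_chooseM hd hj, (Nat.even_iff.2 h).neg_one_pow, one_mul]
  · rw [if_neg h, natCast_negM, cast_chooseM hd hj, (Nat.odd_iff.2 (Nat.mod_two_ne_zero.1 h)).neg_one_pow]
    ring

/-- Residues are reduced: `dcN < p`. [folklore] -/
theorem dcN_lt (d j : ℕ) : dcN p d j < p := by
  unfold dcN negM chooseM
  split_ifs
  · rw [prodM_eq]; exact Nat.mod_lt _ hp.out.pos
  · exact Nat.mod_lt _ hp.out.pos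

end Weights

/-! ### The residue-level decision -/

section Decide

variable (M : TM2ComputableAux Bool Bool) (T : ℕ → ℕ) (x : List Bool) (ρc a : List Bool)

local notation "n" => x.length
local notation "p" => pN M T x.length
local notation "𝔽" => FF M T x.length
local notation "KK" => KN M T x.length
local notation "mm" => mN M T x.length
local notation "CC" => CN M T x.length x
local notation "HH" => HN M T x.length
local notation "prm" => prmN M T x.length
local notation "d" => dM M

/-- **An answer block modulo `p`**: the `b₀` bits from offset `o`. [folklore] -/
def valN (o : ℕ) : ℕ := bitsToNat ((a.drop o).take (b0 M T n)) % p

/-- **The rebuilt oracle at a listed residue point**: the block of its first occurrence. [folklore] -/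
def yAtN (pts : List (List ℕ)) (wl : List ℕ) : ℕ := valN M T x a (pts.idxOf wl * b0 M T n)

/-- The test sum of test `i` on residues. [cite: RubinfeldSudan1996, §4] -/
def ldtSumN (tv : List ℕ) (i : ℕ) : ℕ :=
  sumM p ((List.range (dN M T n + 2)).map fun j =>
    mulM p (dcN p (dN M T n) j) (yAtN M T x a (ptsN M T x tv) (linPtN p (testX KK mm tv i) (testT KK mm tv i) j)))

/-- The coefficient residues of message `i`. [folklore] -/
def csN (tv : List ℕ) (i : ℕ) : List ℕ :=
  (List.range (DN M T n + 1)).map fun j => valN M T x a ((ptsN M T x tv).length * b0 M T n + (i * (DN M T n + 1) + j) * b0 M T n)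

/-- `∑_{e < h} msgᵢ(e)` on residues. [cite: AroraBarakCC2009, §8.3.2] -/
def roundLHS (tv : List ℕ) (i : ℕ) : ℕ := sumM p ((List.range (hN M n)).map fun e => evalM p e (csN M T x a tv i))

/-- The chained claims `0, msg₀(r₀), msg₁(r₁), …` on residues. [cite: AroraBarakCC2009, §8.3.2] -/
def chainN (tv : List ℕ) (i : ℕ) : ℕ := if i = 0 then 0 else evalM p ((rN KK tv).getD (i - 1) 0) (csN M T x a tv (i - 1))

/-- The self-corrected value of the `q`-th read on residues. [cite: AroraBarakCC2009, §8.6.2] -/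
def scValN (tv : List ℕ) (q : ℕ) : ℕ :=
  sumM p ((List.range (dN M T n + 1)).map fun i =>
    mulM p (yAtN M T x a (ptsN M T x tv) (linPtN p (rdPtN M T x tv q) (dirN KK mm (TtN M T n) tv q) (i + 1))) (scWN p (dN M T n) i))

/-- The arities of the families. [folklore] -/
def aritiesN : List ℕ := (descs M n 0 (T n) x).map fun fd => fd.2.1.length

/-- The self-corrected read values, family by family (block `φ` starts after the first `φ` arities). [folklore] -/
def yssN (tv : List ℕ) : List (List ℕ) :=
  (List.range (aritiesN M T x).length).map fun φ =>
    ((((List.range (2 * n + cQ M)).map (scValN M T x a tv)).drop (((aritiesN M T x).take φ).sum)).take ((aritiesN M T x).getD φ 0))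

/-- The verifier's final value on residues. [cite: BFLS1991, §5] -/
def finalLHS (tv : List ℕ) : ℕ :=
  mulM p (psiN p (hN M n) (ktN M T n) (kJN M T n) d n 0 (T n) (seedN KK tv) (rN KK tv) (yssN M T x a tv) (descs M n 0 (T n) x))
    (kernelN p (hN M n) (rN KK tv) (rhoN KK tv))

/-- **The residue-level decision.** [cite: BFLS1991, §5] -/
def decideN : Bool :=
  if (coinParse (bN M T n) p (kT M T x) ρc).1 then
    ((List.range (TtN M T n)).all fun i => ldtSumN M T x a (tvOf M T x ρc) i == 0) &&
    ((List.range KK).all fun i => roundLHS M T x a (tvOf M T x ρc) i == chainN M T x a (tvOf M T x ρc) i) &&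
    (finalLHS M T x a (tvOf M T x ρc) == chainN M T x a (tvOf M T x ρc) KK)
  else true

/-! ### The bridge -/

variable {x}

local notation "τ" => tapeOf M T x ρc
local notation "tv" => tvOf M T x ρc
local notation "PP" => proofFromAnswers M T x (tapeOf M T x ρc) a

/-- `valN` is `valAt`. [folklore] -/
theorem cast_valN (o : ℕ) : ((valN M T x a o : ℕ) : 𝔽) = valAt M T x a o := by
  unfold valN valAt; rw [ZMod.natCast_mod]

/-- Residues of `valN` are reduced. [folklore] -/
theorem valN_lt (o : ℕ) : valN M T x a o < p := Nat.mod_lt _ (pN_prime M T n).pos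

/-- All listed points correspond. [folklore] -/
theorem forall₂_pts : List.Forall₂ PtRel (ptsList M T x τ) (ptsN M T x tv) :=
  List.rel_append (forall₂_ldt M T ρc (x := x)) (forall₂_sc M T ρc (x := x))

/-- **The rebuilt oracle at a listed point, on residues.** [folklore] -/
theorem cast_yAtN {w : Fin mm → 𝔽} {wl : List ℕ} (hw : w ∈ ptsList M T x τ) (hrel : PtRel w wl) :
    ((yAtN M T x a (ptsN M T x tv) wl : ℕ) : 𝔽) = (PP).Y w := by
  show _ = ansY M T x τ a w
  unfold ansY yAtN
  rw [if_pos hw, cast_valN, idxOf_eq_of_forall₂ hrel (fun w' wl' h' => ptRel_biunique hrel h') (forall₂_pts M T ρc (x := x))]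

/-- The sum of a residue list, cast. [folklore] -/
theorem cast_sumM_map_range (f : ℕ → ℕ) (N : ℕ) :
    ((sumM p ((List.range N).map f) : ℕ) : 𝔽) = ∑ j ∈ range N, ((f j : ℕ) : 𝔽) := by
  rw [natCast_sumM, List.map_map, ← sum_map_range]; rfl

/-- **The test sums on residues.** [cite: RubinfeldSudan1996, §4] -/
theorem cast_ldtSumN (i : Fin (TtN M T n)) :
    ((ldtSumN M T x a tv i : ℕ) : 𝔽) = testSum (diffCoeff (dN M T n)) (dN M T n) (PP).Y ((τ).tests i).1 ((τ).tests i).2 := by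
  unfold ldtSumN testSum
  rw [cast_sumM_map_range]
  refine sum_congr rfl fun j hj => ?_
  have hd := dN_succ_lt_pN M T (x := x)
  have hj' := mem_range.1 hj
  have hjp : j < p := by omega
  rw [natCast_mulM, cast_dcN hd (by omega), cast_yAtN M T ρc a ?_ (ptRel_linPt (ptRel_testX M T ρc i) (ptRel_testT M T ρc i) hjp)]
  -- the point is listed among the test points
  refine List.mem_append_left _ (List.mem_flatMap.2 ⟨i, List.mem_finRange i, List.mem_map.2 ⟨j, hj, rfl⟩⟩)

/-! #### Messages -/

/-- The prefixes are listed once each, in order. [folklore] -/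
theorem idxOf_msgArgs {i : ℕ} (hi : i < KK) : (msgArgs M T x τ).idxOf ((List.ofFn (τ).r).take i) = i := by
  have hnd : (msgArgs M T x τ).Nodup := by
    unfold msgArgs
    refine (List.nodup_map_iff_inj_on List.nodup_range).2 fun i hi j hj h => ?_
    have := congrArg List.length h
    rw [List.length_take, List.length_take, List.length_ofFn, min_eq_left (List.mem_range.1 hi).le,
      min_eq_left (List.mem_range.1 hj).le] at this
    exact this
  have hlen : i < (msgArgs M T x τ).length := by unfold msgArgs; simpa using hi
  have := hnd.idxOf_getElem i hlen
  unfold msgArgs at this ⊢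
  simpa using this

/-- **Message `i` rebuilt from the answers.** [folklore] -/
theorem msgs_eq {i : ℕ} (hi : i < KK) :
    msgs prm CC PP τ i = ∑ j ∈ range (DN M T n + 1), Polynomial.C (valAt M T x a
      ((ptsList M T x τ).length * b0 M T n + (i * (DN M T n + 1) + j) * b0 M T n)) * Polynomial.X ^ j := by
  show ansS M T x τ a (τ).ρ (τ).seed ((List.ofFn (τ).r).take i) = _
  unfold ansS
  rw [if_pos ⟨rfl, rfl, mem_msgArgs M T τ hi⟩, idxOf_msgArgs M T ρc hi]

/-- **The coefficients of message `i` on residues.** [folklore] -/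
theorem coeff_msgs {i : ℕ} (hi : i < KK) (j : ℕ) : (msgs prm CC PP τ i).coeff j = (((csN M T x a tv i).getD j 0 : ℕ) : 𝔽) := by
  rw [msgs_eq M T ρc a hi, finsetSum_coeff]
  simp only [coeff_C_mul, coeff_X_pow, mul_ite, mul_one, mul_zero]
  rw [sum_ite_eq (range _) j]
  unfold csN
  by_cases hj : j < DN M T n + 1
  · rw [if_pos (mem_range.2 hj), List.getD_eq_getElem _ _ (by simpa using hj), List.getElem_map, List.getElem_range, cast_valN,
      (forall₂_pts M T ρc (x := x)).length_eq]
  · rw [if_neg (fun h => hj (mem_range.1 h)), List.getD_eq_default _ _ (by simpa using Nat.not_lt.1 hj), Nat.cast_zero]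

/-- Length of the coefficient list. [folklore] -/
@[simp] theorem length_csN (tv' : List ℕ) (i : ℕ) : (csN M T x a tv' i).length = DN M T n + 1 := by simp [csN]

/-- **Messages have degree `≤ D`** (by construction). [folklore] -/
theorem natDegree_msgs_le {i : ℕ} (hi : i < KK) : (msgs prm CC PP τ i).natDegree ≤ (prm).D := by
  rw [msgs_eq M T ρc a hi]
  refine (natDegree_sum_le_of_forall_le _ _ fun j hj => ?_)
  calc (Polynomial.C _ * Polynomial.X ^ j).natDegree ≤ j := natDegree_C_mul_X_pow_le _ _
    _ ≤ DN M T n := Nat.lt_succ_iff.1 (mem_range.1 hj)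

/-- **Evaluating message `i` on residues.** [folklore] -/
theorem eval_msgs {i : ℕ} (hi : i < KK) (b : ℕ) : (msgs prm CC PP τ i).eval ((b : ℕ) : 𝔽) = ((evalM p b (csN M T x a tv i) : ℕ) : 𝔽) := by
  rw [natCast_evalM (two_le_pN M T n), length_csN, eval_eq_sum_range' (lt_of_le_of_lt (natDegree_msgs_le M T ρc a hi) (Nat.lt_succ_self _))]
  exact sum_congr rfl fun j _ => by rw [coeff_msgs M T ρc a hi]

/-- Sums over `H` are sums over `range h`. [folklore] -/
theorem sum_HN (f : 𝔽 → 𝔽) : ∑ e ∈ HH, f e = ∑ e ∈ range (hN M n), f e := by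
  unfold HN DigitPoly.nodes
  rw [sum_image]
  intro e he e' he' h
  exact cast_inj_hN M T (x := x) e e' (mem_range.1 (mem_coe.1 he)) (mem_range.1 (mem_coe.1 he')) h

/-- **The round sums on residues.** [cite: AroraBarakCC2009, §8.3.2] -/
theorem cast_roundLHS {i : ℕ} (hi : i < KK) : ((roundLHS M T x a tv i : ℕ) : 𝔽) = ∑ e ∈ HH, (msgs prm CC PP τ i).eval e := by
  unfold roundLHS
  rw [cast_sumM_map_range, sum_HN]
  exact sum_congr rfl fun e _ => (eval_msgs M T ρc a hi e).symm

/-- **The chained claims on residues.** [cite: AroraBarakCC2009, §8.3.2] -/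
theorem cast_chainN {i : ℕ} (hi : i ≤ KK) : ((chainN M T x a tv i : ℕ) : 𝔽) = SumcheckF.chain 0 (msgs prm CC PP τ) (List.ofFn (τ).r) i := by
  unfold chainN
  rcases i with _ | i
  · simp [SumcheckF.chain]
  · have hi' : i < KK := hi
    rw [if_neg (Nat.succ_ne_zero _), SumcheckF.chain, Nat.add_sub_cancel, ← eval_msgs M T ρc a hi']
    congr 1
    rw [TabEval.getD_ofFn (τ).r ⟨i, hi'⟩, ← (ptRel_r M T ρc (x := x)).2 ⟨i, hi'⟩, ZMod.natCast_zmod_val]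

/-! #### The final check -/

/-- **The self-corrected reads on residues.** [cite: AroraBarakCC2009, §8.6.2] -/
theorem cast_scValN (q : (CC).Qry) : ((scValN M T x a tv (qryEquiv CC q) : ℕ) : 𝔽) = scVal prm CC PP τ q := by
  unfold scValN scVal selfCorrect LineCorrect.correctVal
  rw [cast_sumM_map_range, Lagrange.interpolate_apply, eval_finsetSum, ← Fin.sum_univ_eq_sum_range]
  refine Fintype.sum_congr _ _ fun i => ?_
  have hp3 : p ≠ 2 := by
    have h1 := dN_succ_lt_pN M T (x := x); have h2 := one_le_dN M T (x := x); omega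
  rw [eval_mul, eval_C, natCast_mulM, cast_scWN hp3 _ i]
  congr 1
  have hip : (i : ℕ) + 1 < p := by have := dN_succ_lt_pN M T (x := x); have := i.2; omega
  have h1 := ptRel_rdPt M T ρc (x := x) q
  have h2 := ptRel_dirs M T ρc (x := x) q
  have hrel := ptRel_linPt h1 h2 hip
  have hmem : readAddr (((CC).fam q.1).addr q.2) (τ).r + scNode (F := 𝔽) (dN M T n) i • (τ).dirs q ∈ ptsList M T x τ := by
    refine List.mem_append_right _ ?_
    unfold scList
    refine List.mem_flatMap.2 ⟨qryEquiv CC q, List.mem_finRange _, List.mem_map.2 ⟨i, List.mem_finRange _, ?_⟩⟩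
    exact congrArg (fun q : (CC).Qry => readAddr (((CC).fam q.1).addr q.2) (τ).r + scNode (F := 𝔽) (dN M T n) i • (τ).dirs q)
      (Equiv.symm_apply_apply (qryEquiv CC) q)
  exact cast_yAtN M T ρc a hmem hrel

/-- The arities of the descriptors are the arities of the families. [folklore] -/
theorem aritiesN_spec : (aritiesN M T x).length = (CC).N ∧ ∀ φ : Fin (CC).N, (aritiesN M T x).getD φ 0 = ((CC).fam φ).arity := by
  have hh : (LN M T n).h ≤ p := (hN_lt_pN M T (x := x)).le
  refine ⟨by unfold aritiesN; rw [List.length_map]; exact length_descs (M := M) (L := LN M T n) (P := 0) (T := T n) hh x, fun φ => ?_⟩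
  unfold aritiesN
  rw [show (0 : ℕ) = (fun fd : FamDesc => fd.2.1.length) (0, [], [], []) from rfl, List.getD_map]
  exact (arity_eq (M := M) (L := LN M T n) (P := 0) (T := T n) hh x φ).symm

/-- **The table of self-corrected reads on residues is `(scVal ⟨φ, j⟩)_{φ, j}`.** [folklore] -/
theorem yssN_eq : (List.ofFn fun φ : Fin (CC).N => List.ofFn fun j : Fin ((CC).fam φ).arity => (scVal prm CC PP τ ⟨φ, j⟩).val) =
    yssN M T x a tv := by
  obtain ⟨hlenA, harA⟩ := aritiesN_spec M T (x := x)
  have hnq : 2 * n + cQ M = nQry CC := by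
    rw [← card_qry M T (x := x)]; unfold nQry; simp [CSP.Qry, Fintype.card_sigma]
  apply List.ext_getElem
  · rw [List.length_ofFn, yssN, List.length_map, List.length_range, hlenA]
  intro φ h1 h2
  rw [List.length_ofFn] at h1
  rw [List.getElem_ofFn]
  unfold yssN
  rw [List.getElem_map, List.getElem_range, harA ⟨φ, h1⟩]
  -- offsets: the first `φ` arities sum to the `finSigmaFinEquiv` offset
  have hoff : ((aritiesN M T x).take φ).sum = ∑ φ' : Fin φ, ((CC).fam (Fin.castLE h1.le φ')).arity := by
    rw [← List.sum_ofFn]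
    congr 1
    apply List.ext_getElem
    · simp [hlenA]; omega
    · intro t ht1 ht2
      rw [List.length_ofFn] at ht2
      rw [List.getElem_take, List.getElem_ofFn]
      have := harA ⟨t, by omega⟩
      rw [List.getD_eq_getElem _ _ (by rw [hlenA]; omega)] at this
      rw [this]
      rfl
  apply List.ext_getElem
  · rw [List.length_ofFn, List.length_take, List.length_drop, List.length_map, List.length_range, hnq, hoff]
    refine (min_eq_left ?_).symm
    -- the first `φ + 1` arities sum to at most `nQry`
    have hle := sum_castLE_le (N := (CC).N) (k := φ + 1) h1 (fun ψ => ((CC).fam ψ).arity)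
    rw [Fin.sum_univ_castSucc] at hle
    have e1 : ∑ i : Fin φ, ((CC).fam (Fin.castLE h1 (Fin.castSucc i))).arity = ∑ φ' : Fin φ, ((CC).fam (Fin.castLE h1.le φ')).arity :=
      Fintype.sum_congr _ _ fun i => congrArg (fun ψ => ((CC).fam ψ).arity) (Fin.ext rfl)
    have e2 : ((CC).fam (Fin.castLE h1 (Fin.last φ))).arity = ((CC).fam ⟨φ, h1⟩).arity := congrArg (fun ψ => ((CC).fam ψ).arity) (Fin.ext rfl)
    have e3 : ∑ ψ : Fin (CC).N, ((CC).fam ψ).arity = nQry CC := rfl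
    rw [e1, e2, e3] at hle
    omega
  · intro j hj1 hj2
    rw [List.length_ofFn] at hj1
    rw [List.getElem_ofFn, List.getElem_take, List.getElem_drop, List.getElem_map, List.getElem_range,
      ← cast_scValN M T ρc a ⟨⟨φ, h1⟩, ⟨j, hj1⟩⟩, ZMod.val_natCast, Nat.mod_eq_of_lt (by unfold scValN; rw [sumM_eq]; exact Nat.mod_lt _ (pN_prime M T n).pos)]
    congr 1
    rw [show (qryEquiv CC _ : ℕ) = _ from finSigmaFinEquiv_apply _]
    dsimp only
    rw [hoff]

/-- **The final value on residues.** [cite: BFLS1991, §5] -/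
theorem cast_finalLHS : ((finalLHS M T x a tv : ℕ) : 𝔽) = finalVal HH prm CC PP τ := by
  have hh : (LN M T n).h ≤ p := (hN_lt_pN M T (x := x)).le
  unfold finalLHS finalVal
  rw [natCast_mulM]
  congr 1
  · have e := cast_psiN (M := M) (L := LN M T n) (P := 0) (T := T n) hh x (τ).seed (τ).r (fun φ j => scVal prm CC PP τ ⟨φ, j⟩)
    rw [show seedN KK tv = (τ).seed.val from (val_seed CC _ _ _).symm, ← yssN_eq M T ρc a (x := x), ← zlOf_r M T ρc (x := x)]
    exact e
  · have hr := ptRel_r M T ρc (x := x)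
    have hrho := ptRel_rho M T ρc (x := x)
    have hh' : hN M n ≤ p := hh
    have e := cast_kernelN hh' hr.1 (τ).ρ
    rw [show (List.ofFn fun t : Fin KK => ((τ).ρ t).val) = rhoN KK tv from
      (congrArg List.ofFn (funext hrho.2)).trans (ofFn_getD_eq _ hrho.1 0)] at e
    rw [e]
    exact Fintype.prod_congr _ _ fun t => by rw [← ZMod.natCast_zmod_val ((τ).r t), hr.2 t]; rfl

/-- Casting is injective on residues. [folklore] -/
theorem cast_eq_cast_iff {u v : ℕ} (hu : u < p) (hv : v < p) : ((u : 𝔽) = v) ↔ u = v := by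
  rw [ZMod.natCast_eq_natCast_iff', Nat.mod_eq_of_lt hu, Nat.mod_eq_of_lt hv]

/-- `sumM < p`. [folklore] -/
theorem sumM_lt' (l : List ℕ) : sumM p l < p := by rw [sumM_eq]; exact Nat.mod_lt _ (pN_prime M T n).pos

/-- `chainN < p`. [folklore] -/
theorem chainN_lt (i : ℕ) : chainN M T x a tv i < p := by
  unfold chainN evalM
  split_ifs
  · exact (pN_prime M T n).pos
  · exact sumM_lt' M T (x := x) _

/-- **The decision map of the verifier is the residue-level decision.**
[cite: BFLS1991, §5] [cite: AroraBarakCC2009, Def. 11.4] -/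
theorem decideOf_eq_decideN : decideOf M T x ρc a = decideN M T x ρc a := by
  classical
  unfold decideOf decideN
  by_cases hg : GoodCoins M T x ρc
  · have hg' : (coinParse (bN M T n) p (kT M T x) ρc).1 = true := (coinParse_fst _ _ _ _).2 hg
    rw [if_pos hg, if_pos hg']
    apply Bool.eq_iff_iff.2
    rw [decide_eq_true_iff, Bool.and_eq_true, Bool.and_eq_true, List.all_eq_true, List.all_eq_true]
    simp only [List.mem_range, beq_iff_eq]
    have hK1 : 1 ≤ KK := by unfold KN KIdx LN ktN; dsimp only; omega
    constructor
    · rintro ⟨⟨hrs⟩, ⟨hround, hfinal⟩⟩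
      refine ⟨⟨fun i hi => ?_, fun i hi => ?_⟩, ?_⟩
      · have h := hrs ⟨i, hi⟩
        change testSum (diffCoeff (dN M T n)) (dN M T n) (PP).Y ((τ).tests ⟨i, hi⟩).1 ((τ).tests ⟨i, hi⟩).2 = 0 at h
        rw [← cast_ldtSumN M T ρc a ⟨i, hi⟩, ZMod.natCast_eq_zero_iff] at h
        exact Nat.eq_zero_of_dvd_of_lt h (sumM_lt' M T (x := x) _)
      · have h := (hround i hi).2
        have hb : roundLHS M T x a tv i < p := sumM_lt' M T (x := x) _
        rw [← cast_roundLHS M T ρc a hi, ← cast_chainN M T ρc a hi.le, cast_eq_cast_iff M T hb (chainN_lt M T ρc a _)] at h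
        exact h
      · have h := hfinal
        have hb : finalLHS M T x a tv < p := Nat.mod_lt _ (pN_prime M T n).pos
        rw [← cast_finalLHS M T ρc a, ← cast_chainN M T ρc a le_rfl, cast_eq_cast_iff M T hb (chainN_lt M T ρc a _)] at h
        exact h
    · rintro ⟨⟨hldt, hrounds⟩, hfin⟩
      refine ⟨⟨fun i => ?_⟩, ⟨fun i hi => ⟨natDegree_msgs_le M T ρc a hi, ?_⟩, ?_⟩⟩
      · change testSum (diffCoeff (dN M T n)) (dN M T n) (PP).Y ((τ).tests i).1 ((τ).tests i).2 = 0
        rw [← cast_ldtSumN M T ρc a i, hldt i i.2, Nat.cast_zero]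
      · rw [← cast_roundLHS M T ρc a hi, ← cast_chainN M T ρc a hi.le, hrounds i hi]
      · rw [← cast_finalLHS M T ρc a, ← cast_chainN M T ρc a le_rfl, hfin]
  · have hg' : ¬ (coinParse (bN M T n) p (kT M T x) ρc).1 = true := fun h => hg ((coinParse_fst _ _ _ _).1 h)
    rw [if_neg hg, if_neg hg']

end Decide

end ScaledPCP

end Literature.Computability.Complexity

end
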